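import Summits.AnomalousDissipation.AnomalousDissipation.Theorems.SawtoothPulseCascadeK1LocalisedCascadeAxisCutoff
import Summits.AnomalousDissipation.AnomalousDissipation.Theorems.SawtoothPulseCascadeK1LocalisedCascadeTrapezoidKernel

/-!
# K1loc, line `Spectral` / thin start — helper: THE PASS-THROUGH TERM OF THE HALF-STEP IN SPECTRAL FORM (S-B ↔ S-D glue)

Helper file of the prover lane on the crux `K1LocalisedCascade` (stmt-AnomalousDissipation-19491), route
`SawtoothPulseCascade` (S-D fibre ledger, the bookkeeping step B-5 / assembly).  The half-step window inequalities
`…HalfStepV.sum_window_sq_norm_vstep_le` (and the `Sharp`/modular variants, and the H twins) bound the window energy after a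
half-step by `(junk + √PT)²`, where the PASS-THROUGH term is left in physical form,
`PT = Σ_{n∈F} ∫ ‖A^i_n(b − T_χ b)‖²`, `A^i_n w(x) = ∫ e_{−n}(s) w(x + s e_i) ds` the fibre component (`…StripBlock`),
`T_χ b = Σ_l χ(l) A^j_l b` the input cut-off (`…AxisCutoff`), `F` the fibres met by the window.  The ledger recursion needs `PT` as a
SPECTRAL energy of `b`; this file provides exactly that, in the literal integrand of `…HalfStepV` (general torus `T^d`, axes `i`, `j`):
* `mFourierCoeff_sub_axisCutoff` — `𝓕(b − T_χ b)(k) = (1 − χ(k_j))·𝓕b(k)`;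
* **`sum_integral_norm_sq_passThrough_eq`** — `PT = Σ'_k [k_i ∈ F]·|1 − χ(k_j)|²·‖𝓕b(k)‖²` (fibre Parseval `K1Start.tsum_strip_eq'`);
* `sum_integral_norm_sq_passThrough_le` — if `|1 − χ| ≤ 1` and `χ = 1` on `{p}`: `PT ≤ Σ'_k [k_i ∈ F ∧ ¬p(k_j)]·‖𝓕b(k)‖²`;
* **`sum_integral_norm_sq_passThrough_trapezoid_le`** — for the trapezoid cut-off of `…TrapezoidKernel` (plateau `|m| ≤ L₁`):
  `PT ≤ Σ'_k [k_i ∈ F ∧ L₁ < |k_j|]·‖𝓕b(k)‖²` — only the energy of `b` on the window's fibres and BEYOND the plateau passes.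
(V half-step: `i = 1`, `j = 0`; H half-step: `i = 0`, `j = 1`.)  No definitions; no statement about the crux.
[cite: Grafakos2014, Prop. 3.1.2 (5) and Prop. 3.2.7 (3)] [problem: turb]
-/

-- `Summit.<Summit>.<Problem>`: single-conjunct summit, the duplicate namespace segment is deliberate.
set_option linter.dupNamespace false

noncomputable section

namespace Summit.AnomalousDissipation.AnomalousDissipation.Theorems.SawtoothPulseCascade.K1Window

open MeasureTheory Set Filter Topology UnitAddTorus Function Complex
open scoped Real
open Literature.Analysis.FunctionSpaces Literature.Analysis.FunctionSpaces.Torus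
open Summit.AnomalousDissipation.AnomalousDissipation.Theorems.SawtoothPulseCascade.K1Start

section General

variable {d : Type*} [Fintype d] [DecidableEq d]

/-- **Fourier coefficients of the cut-off complement**: `𝓕(v − T_χ v)(k) = (1 − χ(k_j))·𝓕v(k)` for the axis cut-off
`T_χ v = Σ_m χ(m) A^j_m v` of `…AxisCutoff`. [cite: Grafakos2014, Prop. 3.1.2 (5)] -/
theorem mFourierCoeff_sub_axisCutoff {v : UnitAddTorus d → ℂ} (hv : Continuous v) (j : d) {χ : ℤ → ℂ} {S : Finset ℤ}
    (hχ : ∀ m, m ∉ S → χ m = 0) (k : d → ℤ) :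
    mFourierCoeff (fun x => v x - ∑ m ∈ S, χ m * ∫ s : UnitAddCircle, (fourier (-m) s : ℂ) • v (x + Pi.single j s)) k =
      (1 - χ (k j)) * mFourierCoeff v k := by
  have hTc : Continuous fun x : UnitAddTorus d =>
      ∑ m ∈ S, χ m * ∫ s : UnitAddCircle, (fourier (-m) s : ℂ) • v (x + Pi.single j s) :=
    continuous_finsetSum _ fun m _ => continuous_const.mul (continuous_twistedAxisAvg hv j m)
  have h := Torus.mFourierCoeff_sub (F := ℂ) hv.integrable_unitAddTorus hTc.integrable_unitAddTorus k
  rw [show (fun x => v x - ∑ m ∈ S, χ m * ∫ s : UnitAddCircle, (fourier (-m) s : ℂ) • v (x + Pi.single j s)) =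
      v - fun x => ∑ m ∈ S, χ m * ∫ s : UnitAddCircle, (fourier (-m) s : ℂ) • v (x + Pi.single j s) from rfl, h,
    mFourierCoeff_axisCutoff hv j hχ k]
  ring

/-- **THE PASS-THROUGH TERM IN SPECTRAL FORM**: for `v` continuous, a finite set `F` of fibres along `e_i` and an axis
cut-off `χ` along `e_j` (finitely supported symbol),
`Σ_{n∈F} ∫ ‖A^i_n(v − T_χ v)‖² = Σ'_k [k_i ∈ F]·|1 − χ(k_j)|²·‖𝓕v(k)‖²` — the literal pass-through term of
`…HalfStepV.sum_window_sq_norm_vstep_le` (`i = 1`, `j = 0`) and of its H twin (`i = 0`, `j = 1`), by fibre Parseval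
(`K1Start.tsum_strip_eq'`) and `𝓕(v − T_χ v) = (1 − χ(k_j))𝓕v`. [cite: Grafakos2014, Prop. 3.2.7 (3)] -/
theorem sum_integral_norm_sq_passThrough_eq {v : UnitAddTorus d → ℂ} (hv : Continuous v) (i j : d) (F : Finset ℤ)
    {χ : ℤ → ℂ} {S : Finset ℤ} (hχ : ∀ m, m ∉ S → χ m = 0) :
    ∑ n ∈ F, ∫ x : UnitAddTorus d, ‖∫ s : UnitAddCircle, (fourier (-n) s : ℂ) •
        (v (x + Pi.single i s) - ∑ l ∈ S, χ l * ∫ s' : UnitAddCircle,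
          (fourier (-l) s' : ℂ) • v (x + Pi.single i s + Pi.single j s'))‖ ^ 2 =
      ∑' k : d → ℤ, (if k i ∈ F then ‖1 - χ (k j)‖ ^ 2 else 0) * ‖mFourierCoeff v k‖ ^ 2 := by
  set w : UnitAddTorus d → ℂ := fun y => v y - ∑ l ∈ S, χ l * ∫ s' : UnitAddCircle,
    (fourier (-l) s' : ℂ) • v (y + Pi.single j s') with hw
  have hwc : Continuous w :=
    hv.sub (continuous_finsetSum _ fun m _ => continuous_const.mul (continuous_twistedAxisAvg hv j m))
  have hstrip := tsum_strip_eq' hwc i F (fun _ => (1 : ℝ))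
  simp only [one_mul] at hstrip
  have hL : (∑ n ∈ F, ∫ x : UnitAddTorus d, ‖∫ s : UnitAddCircle, (fourier (-n) s : ℂ) •
        (v (x + Pi.single i s) - ∑ l ∈ S, χ l * ∫ s' : UnitAddCircle,
          (fourier (-l) s' : ℂ) • v (x + Pi.single i s + Pi.single j s'))‖ ^ 2) =
      ∑ m ∈ F, ∫ x : UnitAddTorus d, ‖∫ s : UnitAddCircle, (fourier (-m) s : ℂ) • w (x + Pi.single i s)‖ ^ 2 := rfl
  rw [hL, ← hstrip]
  refine tsum_congr fun k => ?_
  have hk : mFourierCoeff w k = (1 - χ (k j)) * mFourierCoeff v k := mFourierCoeff_sub_axisCutoff hv j hχ k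
  rw [hk, norm_mul, mul_pow]
  split_ifs <;> ring

/-- **Pass-through ≤ energy off the plateau of the cut-off**: if `|1 − χ| ≤ 1` everywhere and `χ = 1` on `{m : p m}`, then
`Σ_{n∈F} ∫ ‖A^i_n(v − T_χ v)‖² ≤ Σ'_k [k_i ∈ F ∧ ¬ p (k_j)]·‖𝓕v(k)‖²`. [cite: Grafakos2014, Prop. 3.2.7 (3)] -/
theorem sum_integral_norm_sq_passThrough_le {v : UnitAddTorus d → ℂ} (hv : Continuous v) (i j : d) (F : Finset ℤ)
    {χ : ℤ → ℂ} {S : Finset ℤ} (hχ : ∀ m, m ∉ S → χ m = 0) (h1 : ∀ m, ‖1 - χ m‖ ≤ 1) {p : ℤ → Prop}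
    [DecidablePred p] (hp : ∀ m, p m → χ m = 1) :
    ∑ n ∈ F, ∫ x : UnitAddTorus d, ‖∫ s : UnitAddCircle, (fourier (-n) s : ℂ) •
        (v (x + Pi.single i s) - ∑ l ∈ S, χ l * ∫ s' : UnitAddCircle,
          (fourier (-l) s' : ℂ) • v (x + Pi.single i s + Pi.single j s'))‖ ^ 2 ≤
      ∑' k : d → ℤ, (if k i ∈ F ∧ ¬ p (k j) then (1 : ℝ) else 0) * ‖mFourierCoeff v k‖ ^ 2 := by
  rw [sum_integral_norm_sq_passThrough_eq hv i j F hχ]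
  have hP : Summable fun k : d → ℤ => ‖mFourierCoeff v k‖ ^ 2 := (hasSum_sq_mFourierCoeff_of_continuous hv).summable
  have hle : ∀ k : d → ℤ, (if k i ∈ F then ‖1 - χ (k j)‖ ^ 2 else 0) * ‖mFourierCoeff v k‖ ^ 2 ≤
      (if k i ∈ F ∧ ¬ p (k j) then (1 : ℝ) else 0) * ‖mFourierCoeff v k‖ ^ 2 := by
    intro k
    refine mul_le_mul_of_nonneg_right ?_ (sq_nonneg _)
    by_cases hF : k i ∈ F
    · by_cases hpk : p (k j)
      · rw [if_pos hF, if_neg (by tauto), hp _ hpk, sub_self, norm_zero]; norm_num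
      · rw [if_pos hF, if_pos ⟨hF, hpk⟩]
        have := h1 (k j)
        nlinarith [norm_nonneg (1 - χ (k j))]
    · rw [if_neg hF, if_neg (by tauto)]
  have hbd : ∀ k : d → ℤ, (if k i ∈ F ∧ ¬ p (k j) then (1 : ℝ) else 0) * ‖mFourierCoeff v k‖ ^ 2 ≤ ‖mFourierCoeff v k‖ ^ 2 :=
    fun k => by split_ifs <;> nlinarith [sq_nonneg ‖mFourierCoeff v k‖]
  have hnn : ∀ k : d → ℤ, 0 ≤ (if k i ∈ F then ‖1 - χ (k j)‖ ^ 2 else 0) * ‖mFourierCoeff v k‖ ^ 2 :=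
    fun k => by positivity
  have hnn' : ∀ k : d → ℤ, 0 ≤ (if k i ∈ F ∧ ¬ p (k j) then (1 : ℝ) else 0) * ‖mFourierCoeff v k‖ ^ 2 :=
    fun k => by positivity
  have hS2 : Summable fun k : d → ℤ => (if k i ∈ F ∧ ¬ p (k j) then (1 : ℝ) else 0) * ‖mFourierCoeff v k‖ ^ 2 :=
    hP.of_nonneg_of_le hnn' hbd
  have hS1 : Summable fun k : d → ℤ => (if k i ∈ F then ‖1 - χ (k j)‖ ^ 2 else 0) * ‖mFourierCoeff v k‖ ^ 2 :=
    hS2.of_nonneg_of_le hnn hle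
  exact hS1.tsum_le_tsum hle hS2

end General

/-! ## The trapezoid cut-off: pass-through ≤ energy beyond the plateau `|k_j| ≤ L₁` -/

section Trapezoid

variable {d : Type*} [Fintype d] [DecidableEq d] {χ : ℤ → ℂ} {L₁ L₂ : ℕ}

/-- For the trapezoid symbol, `|1 − χ(m)| ≤ 1` (as `0 ≤ χ ≤ 1`). [folklore] -/
theorem norm_one_sub_trapezoid_le (hL : L₁ < L₂)
    (hχ : ∀ m : ℤ, χ m = ((min 1 (max 0 (((L₂ : ℝ) - |(m : ℝ)|) / ((L₂ : ℝ) - L₁))) : ℝ) : ℂ)) (m : ℤ) :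
    ‖1 - χ m‖ ≤ 1 := by
  have h := clamp_facts (((L₂ : ℝ) - |(m : ℝ)|) / ((L₂ : ℝ) - L₁)) 0
  have _ := hL
  rw [hχ, show (1 : ℂ) - ((min 1 (max 0 (((L₂ : ℝ) - |(m : ℝ)|) / ((L₂ : ℝ) - L₁))) : ℝ) : ℂ) =
      ((1 - min 1 (max 0 (((L₂ : ℝ) - |(m : ℝ)|) / ((L₂ : ℝ) - L₁))) : ℝ) : ℂ) by push_cast; ring,
    Complex.norm_real, Real.norm_eq_abs, abs_le]
  constructor <;> linarith [h.1, h.2.1]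

/-- **Pass-through of a trapezoid cut-off** (plateau `|m| ≤ L₁`): for `v` continuous and fibres `F` along `e_i`,
`Σ_{n∈F} ∫ ‖A^i_n(v − T_χ v)‖² ≤ Σ'_k [k_i ∈ F ∧ L₁ < |k_j|]·‖𝓕v(k)‖²` — only the energy of `v` on the fibres of the window
and BEYOND the plateau of `χ` passes through the half-step. [cite: Grafakos2014, Prop. 3.2.7 (3)] -/
theorem sum_integral_norm_sq_passThrough_trapezoid_le (hL : L₁ < L₂)
    (hχ : ∀ m : ℤ, χ m = ((min 1 (max 0 (((L₂ : ℝ) - |(m : ℝ)|) / ((L₂ : ℝ) - L₁))) : ℝ) : ℂ))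
    {v : UnitAddTorus d → ℂ} (hv : Continuous v) (i j : d) (F : Finset ℤ) :
    ∑ n ∈ F, ∫ x : UnitAddTorus d, ‖∫ s : UnitAddCircle, (fourier (-n) s : ℂ) •
        (v (x + Pi.single i s) - ∑ l ∈ Finset.Icc (-(L₂ : ℤ)) L₂, χ l * ∫ s' : UnitAddCircle,
          (fourier (-l) s' : ℂ) • v (x + Pi.single i s + Pi.single j s'))‖ ^ 2 ≤
      ∑' k : d → ℤ, (if k i ∈ F ∧ (L₁ : ℤ) < |k j| then (1 : ℝ) else 0) * ‖mFourierCoeff v k‖ ^ 2 := by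
  have h := sum_integral_norm_sq_passThrough_le hv i j F (trapezoid_support hL hχ) (norm_one_sub_trapezoid_le hL hχ)
    (p := fun m : ℤ => |m| ≤ (L₁ : ℤ)) (fun m hm => (trapezoid_values hL hχ m).1 hm)
  refine h.trans_eq (tsum_congr fun k => ?_)
  simp only [not_le]

end Trapezoid

/-! ## §4 The tracked term in spectral form (input of the fibre-`L²` / periodic-sieve half-steps) -/

section Tracked

variable {d : Type*} [Fintype d] [DecidableEq d]

/-- **The tracked term, spectral form**: for the axis cut-off `T_χ v = Σ_m χ(m) A^j_m v`, fibres `F` along `e_i` and weights `φ`,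
`Σ_{n∈F} φ(n)·∫ ‖A^i_n(T_χ v)‖² = Σ'_k [k_i ∈ F]·φ(k_i)·‖χ(k_j)‖²·‖𝓕v(k)‖²` — the weighted tracked-energy term
`Σ_{n∈F} E_n ∫‖A^i_nT‖²` of `…HalfStepL2` / `…HalfStepSieve`, by fibre Parseval (`K1Start.tsum_strip_eq'`) and
`𝓕(T_χ v) = χ(k_j)𝓕v`. [cite: Grafakos2014, Prop. 3.2.7 (3)] -/
theorem sum_weight_integral_norm_sq_tracked_eq {v : UnitAddTorus d → ℂ} (hv : Continuous v) (i j : d) (F : Finset ℤ)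
    {χ : ℤ → ℂ} {S : Finset ℤ} (hχ : ∀ m, m ∉ S → χ m = 0) (φ : ℤ → ℝ) :
    ∑ n ∈ F, φ n * ∫ x : UnitAddTorus d, ‖∫ s : UnitAddCircle, (fourier (-n) s : ℂ) •
        (∑ l ∈ S, χ l * ∫ s' : UnitAddCircle,
          (fourier (-l) s' : ℂ) • v (x + Pi.single i s + Pi.single j s'))‖ ^ 2 =
      ∑' k : d → ℤ, (if k i ∈ F then φ (k i) * ‖χ (k j)‖ ^ 2 else 0) * ‖mFourierCoeff v k‖ ^ 2 := by
  set T : UnitAddTorus d → ℂ := fun y => ∑ l ∈ S, χ l * ∫ s' : UnitAddCircle,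
    (fourier (-l) s' : ℂ) • v (y + Pi.single j s') with hT
  have hTc : Continuous T :=
    continuous_finsetSum _ fun m _ => continuous_const.mul (continuous_twistedAxisAvg hv j m)
  have hstrip := tsum_strip_eq' hTc i F φ
  have hL : (∑ n ∈ F, φ n * ∫ x : UnitAddTorus d, ‖∫ s : UnitAddCircle, (fourier (-n) s : ℂ) •
        (∑ l ∈ S, χ l * ∫ s' : UnitAddCircle,
          (fourier (-l) s' : ℂ) • v (x + Pi.single i s + Pi.single j s'))‖ ^ 2) =
      ∑ m ∈ F, φ m * ∫ x : UnitAddTorus d, ‖∫ s : UnitAddCircle, (fourier (-m) s : ℂ) • T (x + Pi.single i s)‖ ^ 2 := rfl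
  rw [hL, ← hstrip]
  refine tsum_congr fun k => ?_
  have hk : mFourierCoeff T k = χ (k j) * mFourierCoeff v k := mFourierCoeff_axisCutoff hv j hχ k
  rw [hk, norm_mul, mul_pow]
  split_ifs <;> ring

/-- **The tracked term is at most the weighted slab energy**: with `‖χ‖ ≤ 1` and `φ ≥ 0` on `F`,
`Σ_{n∈F} φ(n)·∫ ‖A^i_n(T_χ v)‖² ≤ Σ'_k [k_i ∈ F ∧ χ(k_j) ≠ 0]·φ(k_i)·‖𝓕v(k)‖²` — only the modes of `v` on the fibres of the
window AND inside the support of the cut-off feed the mid-band term. [cite: Grafakos2014, Prop. 3.2.7 (3)] -/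
theorem sum_weight_integral_norm_sq_tracked_le {v : UnitAddTorus d → ℂ} (hv : Continuous v) (i j : d) (F : Finset ℤ)
    {χ : ℤ → ℂ} {S : Finset ℤ} (hχ : ∀ m, m ∉ S → χ m = 0) (hχ1 : ∀ m, ‖χ m‖ ≤ 1) {φ : ℤ → ℝ}
    (hφ : ∀ n ∈ F, 0 ≤ φ n) :
    ∑ n ∈ F, φ n * ∫ x : UnitAddTorus d, ‖∫ s : UnitAddCircle, (fourier (-n) s : ℂ) •
        (∑ l ∈ S, χ l * ∫ s' : UnitAddCircle,
          (fourier (-l) s' : ℂ) • v (x + Pi.single i s + Pi.single j s'))‖ ^ 2 ≤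
      ∑' k : d → ℤ, (if k i ∈ F ∧ χ (k j) ≠ 0 then φ (k i) else 0) * ‖mFourierCoeff v k‖ ^ 2 := by
  classical
  rw [sum_weight_integral_norm_sq_tracked_eq hv i j F hχ φ]
  have hP : Summable fun k : d → ℤ => ‖mFourierCoeff v k‖ ^ 2 := (hasSum_sq_mFourierCoeff_of_continuous hv).summable
  -- a uniform bound on the weights on `F`
  obtain ⟨B, hB⟩ : ∃ B : ℝ, ∀ n ∈ F, φ n ≤ B := by
    rcases F.eq_empty_or_nonempty with h | h
    · exact ⟨0, by simp [h]⟩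
    · exact ⟨F.sup' h φ, fun n hn => Finset.le_sup' φ hn⟩
  have hB0 : ∀ n ∈ F, |φ n| ≤ |B| := fun n hn => by
    rw [abs_of_nonneg (hφ n hn)]; exact (hB n hn).trans (le_abs_self B)
  have hle : ∀ k : d → ℤ, (if k i ∈ F then φ (k i) * ‖χ (k j)‖ ^ 2 else 0) * ‖mFourierCoeff v k‖ ^ 2 ≤
      (if k i ∈ F ∧ χ (k j) ≠ 0 then φ (k i) else 0) * ‖mFourierCoeff v k‖ ^ 2 := by
    intro k
    refine mul_le_mul_of_nonneg_right ?_ (sq_nonneg _)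
    by_cases hF : k i ∈ F
    · by_cases h0 : χ (k j) = 0
      · rw [if_pos hF, h0, norm_zero, if_neg (by tauto)]; simp
      · rw [if_pos hF, if_pos ⟨hF, h0⟩]
        have h1 : ‖χ (k j)‖ ^ 2 ≤ 1 := pow_le_one₀ (norm_nonneg _) (hχ1 _)
        calc φ (k i) * ‖χ (k j)‖ ^ 2 ≤ φ (k i) * 1 := mul_le_mul_of_nonneg_left h1 (hφ _ hF)
          _ = φ (k i) := mul_one _
    · rw [if_neg hF, if_neg (by tauto)]
  have hs1 : Summable fun k : d → ℤ =>
      (if k i ∈ F then φ (k i) * ‖χ (k j)‖ ^ 2 else 0) * ‖mFourierCoeff v k‖ ^ 2 := by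
    refine Summable.of_norm_bounded (g := fun k => |B| * ‖mFourierCoeff v k‖ ^ 2) (hP.mul_left _) fun k => ?_
    rw [Real.norm_eq_abs, abs_mul, abs_of_nonneg (sq_nonneg ‖mFourierCoeff v k‖)]
    refine mul_le_mul_of_nonneg_right ?_ (sq_nonneg _)
    split_ifs with hF
    · rw [abs_mul, abs_of_nonneg (sq_nonneg ‖χ (k j)‖)]
      calc |φ (k i)| * ‖χ (k j)‖ ^ 2 ≤ |B| * 1 :=
            mul_le_mul (hB0 _ hF) (pow_le_one₀ (norm_nonneg _) (hχ1 _)) (sq_nonneg _) (abs_nonneg _)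
        _ = |B| := mul_one _
    · simp
  have hs2 : Summable fun k : d → ℤ => (if k i ∈ F ∧ χ (k j) ≠ 0 then φ (k i) else 0) * ‖mFourierCoeff v k‖ ^ 2 := by
    refine Summable.of_norm_bounded (g := fun k => |B| * ‖mFourierCoeff v k‖ ^ 2) (hP.mul_left _) fun k => ?_
    rw [Real.norm_eq_abs, abs_mul, abs_of_nonneg (sq_nonneg ‖mFourierCoeff v k‖)]
    refine mul_le_mul_of_nonneg_right ?_ (sq_nonneg _)
    split_ifs with hF
    · exact hB0 _ hF.1
    · simp
  exact Summable.tsum_le_tsum hle hs1 hs2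

end Tracked

end Summit.AnomalousDissipation.AnomalousDissipation.Theorems.SawtoothPulseCascade.K1Window
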